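import Literature.Probability.LatticeModels.PSContourFamilies
import Literature.Probability.LatticeModels.RCContourLabels
import HarnessLib

/-!
# Random-cluster contours, III: the exterior of a family of supports (FV Lemma 7.23)

Topic `Literature/Probability/LatticeModels`. Geometry of the region outside all contours:

* `rawSetup d`: the finite non-empty `★`-connected subsets of `ℤ^d` as an abstract `ContourSetup`
  (so that the trichotomy and maximal-member machinery of `PSContourSetup`/`PSContourFamilies`
  apply to bare supports);
* the **first-exit lemma** for `★`-chains;
* **Lemma 7.23 (Friedli–Velenik), geometric part**: for a finite family of pairwise compatible,
  pairwise hull-disjoint supports, the common exterior `⋂ ext` is `★`-connected (reroute through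
  `∂^in ext γ̄`, which is `★`-connected by Lemma 7.19/B.82 and lies in the common exterior) and contains
  every point far away;
* for a configuration `ω` of a volume: its supports are pairwise compatible, the common exterior of all
  supports equals that of the hull-maximal ones, it misses the thick bad set, and — **Lemma 7.23,
  second part** — all its sites are good of the type of the boundary condition
  (`good_of_mem_exteriorAll`);
* the **interpolation lemma**: an `ord`-good site is joined to every site of its `★`-ball by a lattice
  path of open edges inside the ball.

Everything is proved; no named facts.

## References

* S. Friedli, Y. Velenik, *Statistical Mechanics of Lattice Systems*, CUP 2017, §7.3, Lemma 7.23
  (ext is connected and ω = η^# on ext) and Def. 7.22. [FriedliVelenik2017]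
-/

noncomputable section

open Finset Relation

namespace Literature.Probability.LatticeModels

namespace RCC

variable {d : ℕ}

/-! ### Bare supports as an abstract contour setup -/

/-- The finite non-empty `★`-connected sets of `ℤ^d`, viewed as (label-free) abstract contours.
[cite: FriedliVelenik2017, §7.2.6 (supports γ̄)] -/
def rawSetup (d : ℕ) : ContourSetup d where
  Γ := {S : Finset (Site d) // S.Nonempty ∧ StarConn (S : Set (Site d))}
  supp := fun S => S.1
  type := fun _ => Phase.ord
  lab := fun _ _ => Phase.ord
  withSupp := fun S => by
    classical exact if h : S.Nonempty ∧ StarConn (S : Set (Site d)) then {⟨S, h⟩} else ∅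
  mem_withSupp := fun S γ => by
    classical
    constructor
    · intro h
      split_ifs at h with hS
      · rw [mem_singleton] at h; rw [h]
      · exact absurd h (notMem_empty _)
    · rintro rfl
      rw [dif_pos γ.2, mem_singleton]
  supp_nonempty := fun S => S.2.1
  supp_starConn := fun S => S.2.2

/-! ### First exit of a chain from a set -/

/-- **First-exit lemma**: if a `★`-chain inside `U` from a point of `P` cannot be realised inside
`U ∩ P`, then it has a first step leaving `P`: a point `p ∈ P` reached inside `U ∩ P`, `★`-adjacent (in
`U`) to a point `v ∉ P` from which the chain continues. [folklore] -/
theorem exists_first_exit {U P : Set (Site d)} {a b : Site d} (h : ReflTransGen (starRel U) a b) (ha : a ∈ P)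
    (hb : ¬ ReflTransGen (starRel (U ∩ P)) a b) :
    ∃ p v, p ∈ P ∧ v ∉ P ∧ starRel U p v ∧ ReflTransGen (starRel (U ∩ P)) a p ∧ ReflTransGen (starRel U) v b := by
  induction h using ReflTransGen.head_induction_on with
  | refl => exact absurd ReflTransGen.refl hb
  | head hac hcb ih =>
    rename_i a' c
    by_cases hc : c ∈ P
    · have hstep : starRel (U ∩ P) a' c := ⟨hac.1, ⟨hac.2.1, ha⟩, ⟨hac.2.2, hc⟩⟩
      obtain ⟨p, v, hp, hv, hpv, hcp, hvb⟩ := ih hc fun h => hb (ReflTransGen.head hstep h)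
      exact ⟨p, v, hp, hv, hpv, ReflTransGen.head hstep hcp, hvb⟩
    · exact ⟨a', c, ha, hc, hac, ReflTransGen.refl, hcb⟩

/-! ### Lemma 7.23: the common exterior of hull-disjoint compatible supports -/

section CommonExterior

open ContourSetup

/-- **The common exterior** of a family of bare supports. [cite: FriedliVelenik2017, §7.3 (ext = ⋂ ext γ')] -/
def commonExt (𝒮 : Finset (rawSetup d).Γ) : Set (Site d) := {x | ∀ S ∈ 𝒮, x ∈ starExt (S.1 : Finset (Site d))}

/-- Far points lie in the common exterior. [cite: FriedliVelenik2017, §7.3] -/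
theorem mem_commonExt_of_far (hd : 2 ≤ d) (𝒮 : Finset (rawSetup d).Γ) {R : ℕ} (hR : ∀ S ∈ 𝒮, (S.1 : Finset (Site d)) ⊆ box d R)
    {z : Site d} (hz : z ∉ box d R) : z ∈ commonExt 𝒮 := fun S hS => mem_starExt_of_not_mem_box hd (hR S hS) hz

/-- The exterior boundary of the hull of a member lies in the common exterior of a pairwise compatible,
pairwise hull-disjoint family. [cite: FriedliVelenik2017, §7.3, proof of Lemma 7.23] -/
theorem exBoundary_hull_subset_commonExt (hd : 2 ≤ d) {𝒮 : Finset (rawSetup d).Γ}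
    (hc : (𝒮 : Set (rawSetup d).Γ).Pairwise (rawSetup d).Compat)
    (hh : (𝒮 : Set (rawSetup d).Γ).Pairwise fun S S' => Disjoint ((rawSetup d).hull S) ((rawSetup d).hull S'))
    {S : (rawSetup d).Γ} (hS : S ∈ 𝒮) : (exBoundary (starHullFinset S.1) : Set (Site d)) ⊆ commonExt 𝒮 := by
  intro u hu S' hS'
  obtain ⟨huh, x, hx, hxu⟩ := mem_exBoundary.1 (mem_coe.1 hu)
  by_cases hSS' : S = S'
  · subst hSS'
    by_contra hue
    exact huh ((mem_starHullFinset hd).2 hue)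
  · -- `u` is `★`-adjacent to the hull of `S`, which misses the hull of `S'`; if `u ∈ hull S'` then `u ∈ int S'`
    -- and its neighbour `x ∈ hull S` would be in `hull S'` too
    by_contra hue
    have huh' : u ∈ (rawSetup d).hull S' := (mem_starHullFinset hd).2 hue
    have hdis := hh (mem_coe.2 hS) (mem_coe.2 hS') hSS'
    have hcomp := hc (mem_coe.2 hS) (mem_coe.2 hS') hSS'
    -- `x ∈ supp S` (a hull point adjacent to a non-hull point lies in the support)
    have hxS : x ∈ (rawSetup d).supp S := by
      rcases (mem_hull_iff hd (S := rawSetup d)).1 hx with h | hxi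
      · exact h
      · exfalso
        have huS : u ∉ (rawSetup d).supp S := fun h' => huh (supp_subset_hull hd (S := rawSetup d) S h')
        exact huh (intr_subset_hull (S := rawSetup d) S (mem_starInt_of_reflTransGen hd hxi
          (ReflTransGen.single ⟨hxu, fun h' => not_mem_supp_of_mem_intr hd (S := rawSetup d) hxi (mem_coe.1 h'),
            fun h' => huS (mem_coe.1 h')⟩)))
    -- `u ∉ supp S'` by compatibility, so `u ∈ int S'`, and then `x ∈ hull S'`
    have huS' : u ∉ (rawSetup d).supp S' := not_mem_supp_of_mem_starBall_of_compat hcomp hxS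
      ((adj_iff_mem_starBall.1 hxu).1)
    have hui : u ∈ (rawSetup d).intr S' := ((mem_hull_iff hd (S := rawSetup d)).1 huh').resolve_left huS'
    have hxS' : x ∉ (rawSetup d).supp S' := fun h' => Finset.disjoint_left.1 (disjoint_supp_of_compat hcomp) hxS h'
    have hxi' : x ∈ (rawSetup d).intr S' := mem_starInt_of_reflTransGen hd hui
      (ReflTransGen.single ⟨hxu.symm, fun h' => huS' (mem_coe.1 h'), fun h' => hxS' (mem_coe.1 h')⟩)
    exact Finset.disjoint_left.1 hdis hx (intr_subset_hull (S := rawSetup d) S' hxi')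

/-- **Lemma 7.23 (Friedli–Velenik), geometric part**: the common exterior of a finite family of
pairwise compatible, pairwise hull-disjoint supports is `★`-connected.
[cite: FriedliVelenik2017, §7.3, Lemma 7.23] -/
theorem starConn_commonExt (hd : 2 ≤ d) (𝒮 : Finset (rawSetup d).Γ)
    (hc : (𝒮 : Set (rawSetup d).Γ).Pairwise (rawSetup d).Compat)
    (hh : (𝒮 : Set (rawSetup d).Γ).Pairwise fun S S' => Disjoint ((rawSetup d).hull S) ((rawSetup d).hull S')) :
    StarConn (commonExt 𝒮) := by
  classical
  induction 𝒮 using Finset.induction_on with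
  | empty =>
    intro x _ y _
    exact reflTransGen_starRel_mono (fun z _ => fun S hS => absurd hS (notMem_empty S)) (reflTransGen_starRel_univ x y)
  | insert S 𝒮 hS𝒮 ih =>
    have hc' : (𝒮 : Set (rawSetup d).Γ).Pairwise (rawSetup d).Compat := hc.mono (coe_subset.2 (subset_insert _ _))
    have hh' : (𝒮 : Set (rawSetup d).Γ).Pairwise fun S S' => Disjoint ((rawSetup d).hull S) ((rawSetup d).hull S') :=
      hh.mono (coe_subset.2 (subset_insert _ _))
    have hconn := ih hc' hh'
    -- notation
    set E := commonExt 𝒮 with hE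
    set E' := commonExt (insert S 𝒮) with hE'
    have hE'eq : E' = E ∩ starExt (S.1 : Finset (Site d)) := by
      ext z; simp only [hE', hE, commonExt, Set.mem_setOf_eq, Set.mem_inter_iff, mem_insert, forall_eq_or_imp]; tauto
    -- the boundary `B = ∂^ex (hull S)` is `★`-connected and lies in `E'`
    set B : Set (Site d) := ↑(exBoundary (starHullFinset S.1)) with hB
    have hBconn : StarConn B := (starConn_boundaries_starHull hd S.2.2).1
    have hBE' : B ⊆ E' := exBoundary_hull_subset_commonExt hd hc hh (mem_insert_self S 𝒮)
    -- every point of `E'` is chained in `E'` to a far point `z₀`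
    obtain ⟨R, hR⟩ : ∃ R : ℕ, ∀ S' ∈ insert S 𝒮, (S'.1 : Finset (Site d)) ⊆ box d R := by
      refine ⟨(insert S 𝒮).sup fun S' => boxRadius S'.1, fun S' hS' => ?_⟩
      exact (subset_box_boxRadius _).trans (box_mono d (le_sup (f := fun S' : (rawSetup d).Γ => boxRadius S'.1) hS'))
    set z₀ : Site d := fun _ => (R : ℤ) + 1 with hz₀
    have hz₀far : z₀ ∉ box d R := mem_farSet_iff_not_mem_box.1 (corner_mem_farSet (by omega) le_rfl)
    have hz₀E' : z₀ ∈ E' := mem_commonExt_of_far hd _ hR hz₀far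
    have hz₀E : z₀ ∈ E := by rw [hE'eq] at hz₀E'; exact hz₀E'.1
    have key : ∀ x ∈ E', ReflTransGen (starRel E') x z₀ := by
      intro x hx
      have hxE : x ∈ E := by rw [hE'eq] at hx; exact hx.1
      have hxe : x ∈ starExt (S.1 : Finset (Site d)) := by rw [hE'eq] at hx; exact hx.2
      have hz₀e : z₀ ∈ starExt (S.1 : Finset (Site d)) := by rw [hE'eq] at hz₀E'; exact hz₀E'.2
      have hchain := hconn x hxE z₀ hz₀E
      by_cases hgood : ReflTransGen (starRel (E ∩ starExt (S.1 : Finset (Site d)))) x z₀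
      · rw [hE'eq]; exact hgood
      · -- first exit from `ext S` on the way out, and on the way back
        obtain ⟨p, v, hp, hv, hpv, hxp, -⟩ := exists_first_exit (P := starExt (S.1 : Finset (Site d))) hchain hxe hgood
        obtain ⟨q, v', hq, hv', hqv', hz₀q, -⟩ := exists_first_exit (P := starExt (S.1 : Finset (Site d)))
          (reflTransGen_starRel_symm hchain) hz₀e fun h => hgood (reflTransGen_starRel_symm h)
        have hpB : p ∈ B :=
          mem_coe.2 (mem_exBoundary.2 ⟨fun h => (mem_starHullFinset hd).1 h hp, v, (mem_starHullFinset hd).2 hv, hpv.1.symm⟩)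
        have hqB : q ∈ B :=
          mem_coe.2 (mem_exBoundary.2 ⟨fun h => (mem_starHullFinset hd).1 h hq, v', (mem_starHullFinset hd).2 hv', hqv'.1.symm⟩)
        have h1 : ReflTransGen (starRel E') x p := by rw [hE'eq]; exact hxp
        have h2 : ReflTransGen (starRel E') p q := reflTransGen_starRel_mono hBE' (hBconn p hpB q hqB)
        have h3 : ReflTransGen (starRel E') q z₀ := by rw [hE'eq]; exact reflTransGen_starRel_symm hz₀q
        exact (h1.trans h2).trans h3
    intro x hx y hy
    exact (key x hx).trans (reflTransGen_starRel_symm (key y hy))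

end CommonExterior

/-! ### The exterior of all contours of a configuration -/

section Configuration

open ContourSetup

variable {σ : Phase} {F ω : Finset (Sym2 (Site d))}

variable (σ F ω) in
/-- The supports of a configuration as bare abstract contours. [cite: FriedliVelenik2017, §7.2.6] -/
def rawSupports : Finset (rawSetup d).Γ :=
  (supports σ F ω).attach.image fun S => ⟨S.1, (support_props S.2).2.1, (support_props S.2).2.2.1⟩

/-- Membership in `rawSupports`. [folklore] -/
theorem mem_rawSupports {T : (rawSetup d).Γ} : T ∈ rawSupports σ F ω ↔ T.1 ∈ supports σ F ω := by
  rw [rawSupports, mem_image]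
  constructor
  · rintro ⟨S, -, rfl⟩; exact S.2
  · intro h; exact ⟨⟨T.1, h⟩, mem_attach _ _, rfl⟩

/-- **The supports of a configuration are pairwise compatible.** [cite: FriedliVelenik2017, §7.3 ("all contours appearing in a same configuration are compatible")] -/
theorem pairwise_compat_rawSupports : ((rawSupports σ F ω : Finset (rawSetup d).Γ) : Set (rawSetup d).Γ).Pairwise (rawSetup d).Compat := by
  intro T hT T' hT' hne x hx y hy
  exact supDist_gt_one_of_ne (mem_rawSupports.1 (mem_coe.1 hT)) (mem_rawSupports.1 (mem_coe.1 hT')) (fun h => hne (Subtype.ext h)) hx hy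

variable (σ F ω) in
/-- **The exterior of all contours of a configuration**: the points exterior to every support.
[cite: FriedliVelenik2017, §7.3 (ext = ⋂_{γ'} ext γ')] -/
def exteriorAll : Set (Site d) := {x | ∀ S ∈ supports σ F ω, x ∈ starExt S}

variable (σ F ω) in
/-- The hull-maximal supports (the supports of the external contours). [cite: FriedliVelenik2017, §7.3, Def. 7.22] -/
def maxSupports : Finset (rawSetup d).Γ := (rawSetup d).maxP (fun _ => True) (rawSupports σ F ω)

/-- The exterior of all contours is the common exterior of the hull-maximal supports. [cite: FriedliVelenik2017, §7.3] -/
theorem exteriorAll_eq_commonExt (hd : 2 ≤ d) : exteriorAll σ F ω = commonExt (maxSupports σ F ω) := by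
  classical
  ext x
  constructor
  · intro hx T hT
    exact hx T.1 (mem_rawSupports.1 (maxP_subset (S := rawSetup d) _ hT))
  · intro hx S hS
    have hT : (⟨S, (support_props hS).2.1, (support_props hS).2.2.1⟩ : (rawSetup d).Γ) ∈ rawSupports σ F ω := mem_rawSupports.2 hS
    obtain ⟨T, hTmax, hTS⟩ := exists_maxP_above (S := rawSetup d) (P := fun _ => True) hd hT trivial
    have hxT := hx T hTmax
    rcases hTS with rfl | ⟨A, hA, hsub⟩
    · exact hxT
    · -- `hull S ⊆ A ⊆ hull T`, so `ext T ⊆ ext S`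
      by_contra hxS
      have hxh : x ∈ starHullFinset S := (mem_starHullFinset hd).2 hxS
      exact (mem_starHullFinset hd).1 (intr_subset_hull (S := rawSetup d) T (subset_intr_of_mem_ints (S := rawSetup d) hA (hsub hxh))) hxT

/-- **Lemma 7.23, first part, for configurations**: the exterior of all contours is `★`-connected.
[cite: FriedliVelenik2017, §7.3, Lemma 7.23] -/
theorem starConn_exteriorAll (hd : 2 ≤ d) : StarConn (exteriorAll σ F ω) := by
  classical
  rw [exteriorAll_eq_commonExt hd]
  have hsub : maxSupports σ F ω ⊆ rawSupports σ F ω := maxP_subset (S := rawSetup d) _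
  exact starConn_commonExt hd _ (pairwise_compat_rawSupports.mono (coe_subset.2 hsub))
    (pairwise_disjoint_hull_maxP (S := rawSetup d) hd pairwise_compat_rawSupports)

/-- Points outside a box containing the thick bad set are exterior to all contours. [cite: FriedliVelenik2017, §7.3] -/
theorem mem_exteriorAll_of_not_mem_box (hd : 2 ≤ d) {R : ℕ} (hR : thick σ F ω ⊆ box d R) {z : Site d} (hz : z ∉ box d R) :
    z ∈ exteriorAll σ F ω := fun _ hS => mem_starExt_of_not_mem_box hd ((support_props hS).1.trans hR) hz

/-- The exterior of all contours misses the thick bad set. [cite: FriedliVelenik2017, §7.3, Lemma 7.23] -/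
theorem not_mem_thick_of_mem_exteriorAll {x : Site d} (hx : x ∈ exteriorAll σ F ω) : x ∉ thick σ F ω := fun hxt => by
  obtain ⟨S, hS, hxS⟩ := mem_thick_iff_exists_support.1 hxt
  exact (hx S hS).1 hxS

/-- Sites outside the core of the volume are good of the boundary type (all their ball edges are pinned).
[cite: FriedliVelenik2017, §7.3, Lemma 7.20] -/
theorem good_of_not_mem_core {V : Finset (Site d)} (hω : ω ⊆ freeEdges V) {x : Site d} (hx : x ∉ core V) :
    Good σ (freeEdges V) ω σ x := by
  have hfree : ∀ e ∈ ballEdges x, e ∉ freeEdges V := fun e he heF =>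
    hx ((mem_freeEdges.1 heF).2 (mem_ballEdges_iff.1 he).2)
  cases σ with
  | ord => exact fun e he => (eOpen_iff_of_not_mem hω (hfree e he)).2 rfl
  | dis => exact fun e he h => absurd ((eOpen_iff_of_not_mem hω (hfree e he)).1 h) (by decide)

/-- **Lemma 7.23, second part**: every site of the exterior of all contours of a configuration of the
volume `V` is good, of the type of the boundary condition. [cite: FriedliVelenik2017, §7.3, Lemma 7.23 (ω_i = η^#_i for i ∈ ext)] -/
theorem good_of_mem_exteriorAll (hd : 2 ≤ d) {V : Finset (Site d)} (hω : ω ⊆ freeEdges V) {x : Site d}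
    (hx : x ∈ exteriorAll σ (freeEdges V) ω) : Good σ (freeEdges V) ω σ x := by
  have hd1 : 1 ≤ d := by omega
  -- a far point, good by pinning
  set R := max (boxRadius V) (boxRadius (thick σ (freeEdges V) ω)) with hR
  set z₀ : Site d := fun _ => (R : ℤ) + 1
  have hz₀ : z₀ ∉ box d R := mem_farSet_iff_not_mem_box.1 (corner_mem_farSet hd1 le_rfl)
  have hz₀V : z₀ ∉ core V := fun h => hz₀ ((subset_box_boxRadius V).trans (box_mono d (le_max_left _ _))
    (inner1_subset V (core_subset_inner1 V h)))
  have hz₀E : z₀ ∈ exteriorAll σ (freeEdges V) ω :=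
    mem_exteriorAll_of_not_mem_box hd ((subset_box_boxRadius _).trans (box_mono d (le_max_right _ _))) hz₀
  have hz₀good := good_of_not_mem_core (σ := σ) hω hz₀V
  -- the chain in the exterior consists of non-bad sites
  have hchain := starConn_exteriorAll hd x hx z₀ hz₀E
  have hG : ∀ z ∈ exteriorAll σ (freeEdges V) ω, ¬ Bad σ (freeEdges V) ω z := fun z hz hzb =>
    not_mem_thick_of_mem_exteriorAll hz (mem_thick_of_bad hω hzb)
  have hiff := ordGood_iff_of_chain hd1 hG hchain
  have hxnb := hG x hx
  cases σ with
  | ord => exact hiff.2 hz₀good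
  | dis =>
    intro e he ho
    have hno : ¬ OrdGood Phase.dis (freeEdges V) ω x := fun h => not_ordGood_of_disGood hd1 hz₀good (hiff.1 h)
    have hdis : DisGood Phase.dis (freeEdges V) ω x := by by_contra hnd; exact hxnb ⟨hno, hnd⟩
    exact hdis e he ho

end Configuration

/-! ### Interpolation: open lattice paths inside the ball of an `ord`-good site -/

/-- **An `ord`-good site is joined to every site of its `★`-ball by a lattice path of open edges inside
the ball** (change the coordinates one at a time). [cite: FriedliVelenik2017, §7.2.1 (★-adjacent ord-correct sites belong to the same cluster)] -/
theorem reflTransGen_open_of_ordGood {σ : Phase} {F ω : Finset (Sym2 (Site d))} {x : Site d} (hx : OrdGood σ F ω x)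
    {U : Set (Site d)} (hU : (starBall x : Set (Site d)) ⊆ U) {y : Site d} (hy : y ∈ starBall x) :
    ReflTransGen (fun a b => ((zdGraph d).Adj a b ∧ EOpen σ F ω s(a, b)) ∧ a ∈ U ∧ b ∈ U) x y := by
  -- induction on the number of coordinates where `z` differs from `y`, for `z ∈ starBall x` with `z ≤ ...`
  suffices key : ∀ (n : ℕ) (z : Site d), z ∈ starBall x → (∀ j, z j = x j ∨ z j = y j) → #(univ.filter fun j => z j ≠ y j) ≤ n →
      ReflTransGen (fun a b => ((zdGraph d).Adj a b ∧ EOpen σ F ω s(a, b)) ∧ a ∈ U ∧ b ∈ U) z y from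
    key d x (mem_starBall_self x) (fun j => Or.inl rfl) ((card_filter_le _ _).trans (by simp))
  have hy' := supDist_le_iff.1 (mem_starBall.1 hy)
  intro n
  induction n with
  | zero =>
    intro z _ _ hn
    have : z = y := funext fun j => by
      by_contra hj
      have : 0 < #(univ.filter fun j => z j ≠ y j) := card_pos.2 ⟨j, mem_filter.2 ⟨mem_univ j, hj⟩⟩
      omega
    subst this; exact ReflTransGen.refl
  | succ n ih =>
    intro z hz hzxy hn
    by_cases hall : ∀ j, z j = y j
    · rw [show z = y from funext hall]
    · push Not at hall
      obtain ⟨j, hj⟩ := hall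
      have hzj : z j = x j := (hzxy j).resolve_right hj
      set z' := Function.update z j (y j) with hz'
      have hz'ball : z' ∈ starBall x := by
        rw [mem_starBall, supDist_le_iff]
        intro k
        by_cases hk : k = j
        · subst hk; rw [hz', Function.update_self]; exact hy' k
        · rw [hz', Function.update_of_ne hk]; exact supDist_le_iff.1 (mem_starBall.1 hz) k
      have hadj : (zdGraph d).Adj z z' := by
        have h1 := hy' j
        rw [hzj] at hj
        rcases (show y j = x j + 1 ∨ y j = x j - 1 by omega) with h | h
        · refine (zdGraph_adj_iff _ _).2 ⟨j, Or.inl (funext fun k => ?_)⟩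
          by_cases hk : k = j
          · subst hk; simp [hz', h, hzj]
          · simp [hz', Function.update_of_ne hk, Pi.single_eq_of_ne hk]
        · refine (zdGraph_adj_iff _ _).2 ⟨j, Or.inr (funext fun k => ?_)⟩
          by_cases hk : k = j
          · subst hk; simp [hz', h, hzj]
          · simp [hz', Function.update_of_ne hk, Pi.single_eq_of_ne hk]
      have hopen : EOpen σ F ω s(z, z') :=
        hx _ (mem_ballEdges_iff.2 ⟨(SimpleGraph.mem_edgeSet _).2 hadj, by
          rw [coBall_mk, mem_inter, mem_starBall_comm (x := z), mem_starBall_comm (x := z')]; exact ⟨hz, hz'ball⟩⟩)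
      refine ReflTransGen.head ⟨⟨hadj, hopen⟩, hU (mem_coe.2 hz), hU (mem_coe.2 hz'ball)⟩ (ih z' hz'ball (fun k => ?_) ?_)
      · by_cases hk : k = j
        · subst hk; right; rw [hz', Function.update_self]
        · rw [hz', Function.update_of_ne hk]; exact hzxy k
      · have hset : (univ.filter fun k => z' k ≠ y k) = (univ.filter fun k => z k ≠ y k).erase j := by
          ext k
          simp only [mem_filter, mem_univ, true_and, mem_erase]
          by_cases hk : k = j
          · subst hk; simp [hz']
          · rw [hz', Function.update_of_ne hk]; tauto
        rw [hset, card_erase_of_mem (mem_filter.2 ⟨mem_univ j, by rw [hzj]; exact fun h => hj (hzj.trans h)⟩)]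
        omega


end RCC

end Literature.Probability.LatticeModels

end
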